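import Summits.QuantumFields.YangMills.Theorems.ColdStartUniversalityUniformColdStartMixingFixedCutoffDynamicVarianceWindow
import Summits.QuantumFields.YangMills.Theorems.ColdStartUniversalityLatticeLangevinWilsonLoopConcentration
import HarnessLib

/-!
# Route `ColdStartUniversality` (fixed-cut-off package, Bakry–Émery side, GRADIENT half): DYNAMIC CONCENTRATION OF SPATIALLY AVERAGED WILSON
# LOOPS — `Var((L³)⁻¹Σ_x W_(R×T)(x)(U_t)) ≤ 48(R+T)²/((1 − 12|β'|)·L³)` along EVERY SZZ solution from a deterministic start, all `t`, all `L`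

Helper file (seat `ym-line-csu-p1`, g29; `--supports stmt-QuantumFields-24809`).  The Wilson-loop twin of `…FixedCutoffDynamicVarianceWindow`:
the dynamic variance bound `wilson_solution_variance_le_uniform` (local Poincaré inequality for the SZZ semigroup, g29) read with g27's carré
bound for the spatially averaged `R × T` rectangular Wilson loop (`wilson_loopAverage_carre_le`, `loopAverage_coords_eq`, S12 `wilsonLoop`):
* ★★★ `wilson_solution_loopAverage_variance_le_uniform` — for every torus size `L`, `|β'| < 1/12`, directions `i, j`, side lengths `R, T`, every
  strong solution `U` of the SU(2) SZZ Langevin SDE from a deterministic start (e.g. the cold start) and every lattice time `t`: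
  `∫ (W̄_(R×T)(U_t) − E[W̄_(R×T)(U_t)])² dP ≤ 48(R+T)²/((1 − 12|β'|)·L³)` (`L³ = #sites`) — the same CLT-scale bound as at equilibrium
  (`wilson_loopAverage_variance_uniform`, g27), at all times along the non-stationary evolution;
* ★★ `wilsonLoop_dynamicVariance_fixedCutoff_window` — the same at the route's cut-off coupling `β'_K = (γε_K)⁻¹/2` in the window `γε_K > 6`
  (`1 − 12|β'_K| = 1 − 6/(γε_K)`, `L_K = (F.P K).sitesPerDir 0`).
THEOREMS ONLY, no definition, no sorry.  PLANNER-FACING, HONEST: fixed cut-off; the window `γε_K > 6` contains only the coarse cut-offs; these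
are `½Re tr` loops averaged over the torus, not Bałaban's block averages `avgObs`; nothing K-uniform; 24809 is ASIDE and NOT restated; no crux,
rung or summit statement is proved; the Yang–Mills mass gap is NOT proved.
-/

set_option autoImplicit false

noncomputable section

namespace Summit.QuantumFields.YangMills.Theorems.ColdStartUniversality

open MeasureTheory ProbabilityTheory Matrix Complex Finset Filter Set Metric
open scoped ComplexConjugate BigOperators Matrix NNReal ENNReal Topology
open Literature.Probability.Process Literature.MathematicalPhysics.QuantumFieldTheory
open Literature.MathematicalPhysics.QuantumFieldTheory.Balaban1983to89
open Literature.MathematicalPhysics.QuantumLattice (fundamentalRep fundamentalLatticeRep continuous_fundamentalRep fundamentalRep_apply)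

variable {L : ℕ} [NeZero L]

/-- ★★★ **Dynamic concentration of spatially averaged `R × T` Wilson loops along every SZZ solution, uniform in time and volume.**
For every `L`, `|β'| < 1/12`, `i j : Fin 3`, `R T : ℕ`, every strong solution `U` of the SU(2) lattice Langevin SDE from a deterministic start
and every lattice time `t`:  `∫ (W̄_(R×T)(U_t) − E[W̄_(R×T)(U_t)])² dP ≤ 48(R+T)²/((1 − 12|β'|)·#sites)`.
[cite: BakryGentilLedoux2014, Thm 4.7.2 (ii); ShenZhuZhu2022 §4 Cor. 4.7] -/
theorem wilson_solution_loopAverage_variance_le_uniform (L : ℕ) [NeZero L] (β' : ℝ) (hβ : |β'| < 1 / 12) (i j : Fin 3) (R T : ℕ)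
    (t : ℝ≥0) (x₀ : (GaugeConfig 3 L (Matrix.specialUnitaryGroup (Fin 2) ℂ)))
    (Ω : Type) [MeasurableSpace Ω] (P : Measure Ω) [IsProbabilityMeasure P]
    (W : ℝ≥0 → Ω → (Edge 3 L × NoiseIdx 2 → ℝ)) (hW : IsFlatBrownian W P)
    (U : ℝ≥0 → Ω → (GaugeConfig 3 L (Matrix.specialUnitaryGroup (Fin 2) ℂ))) (hU0 : ∀ ω, U 0 ω = x₀)
    (hU : (latticeLangevinDynamics (fundamentalLatticeRep 2) β').IsSolution (fundamentalRep (Fin 2)) hW.natFiltration P W U) :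
    ∫ ω, ((((Fintype.card (Site 3 L) : ℝ))⁻¹ * ∑ x : Site 3 L, wilsonLoop (fundamentalRep (Fin 2)) x i j R T (U t ω)) - ∫ ω', (((Fintype.card (Site 3 L) : ℝ))⁻¹ * ∑ x : Site 3 L, wilsonLoop (fundamentalRep (Fin 2)) x i j R T (U t ω')) ∂P) ^ 2 ∂P ≤
      48 * ((R : ℝ) + T) ^ 2 / ((1 - 12 * |β'|) * (Fintype.card (Site 3 L) : ℝ)) := by
  classical
  haveI := secondCountableTopology_su2
  haveI := borelSpace_config L
  have hρ : 0 < 1 - 12 * |β'| := by linarith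
  have hS : (0 : ℝ) < (Fintype.card (Site 3 L) : ℝ) := card_site_three_pos L
  set co : (GaugeConfig 3 L (Matrix.specialUnitaryGroup (Fin 2) ℂ)) → (Edge 3 L × Fin 2 × Fin 2 × Bool → ℝ) := (fun (V : GaugeConfig 3 L (Matrix.specialUnitaryGroup (Fin 2) ℂ)) (q : Edge 3 L × Fin 2 × Fin 2 × Bool) => (fun z : ℂ => if q.2.2.2 then z.im else z.re) ((fundamentalRep (Fin 2) (V q.1) : Matrix (Fin 2) (Fin 2) ℂ) q.2.1 q.2.2.1)) with hco
  set fp : (Edge 3 L × Fin 2 × Fin 2 × Bool → ℝ) → ℝ := (fun y : (Edge 3 L × Fin 2 × Fin 2 × Bool → ℝ) => (2 * (Fintype.card (Site 3 L) : ℝ))⁻¹ * ∑ x : Site 3 L, ((((((List.range R).map (fun m : ℕ => ((Pi.single i ((m : ℕ) : ZMod L) : Site 3 L), i, false)) ++ (List.range T).map (fun m : ℕ => ((Pi.single i ((R : ℕ) : ZMod L) : Site 3 L) + (Pi.single j ((m : ℕ) : ZMod L) : Site 3 L), j, false)) ++ ((List.range R).map (fun m : ℕ => ((Pi.single j ((T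 : ℕ) : ZMod L) : Site 3 L) + (Pi.single i ((m : ℕ) : ZMod L) : Site 3 L), i, true))).reverse ++ ((List.range T).map (fun m : ℕ => ((Pi.single j ((m : ℕ) : ZMod L) : Site 3 L), j, true))).reverse).map (fun q : Site 3 L × Fin 3 × Bool => ((x + q.1, q.2.1), q.2.2))).map (fun a : Edge 3 L × Bool => if a.2 then ((fun (ee : Edge 3 L) => Matrix.of fun (i j : Fin 2) => ((y (ee, i, j, false) : ℝ) : ℂ) + ((y (ee, i, j, true) : ℝ) : ℂ) * Complex.I) a.1)ᴴ else (fun (ee : Edge 3 L) => Matrix.of fun (i j : Fin 2) => ((y (ee, i, j, false) : ℝ) : ℂ) + ((y (ee, i, j, true) : ℝ) : ℂ) * Complex.I) a.1)).prod)).trace.re) with hfp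
  have hfpC : ContDiff ℝ 5 fp := contDiff_loopAverage _ _
  have hval : ∀ V : (GaugeConfig 3 L (Matrix.specialUnitaryGroup (Fin 2) ℂ)), fp (co V) = (((Fintype.card (Site 3 L) : ℝ))⁻¹ * ∑ x : Site 3 L, wilsonLoop (fundamentalRep (Fin 2)) x i j R T V) := fun V => loopAverage_coords_eq V i j R T
  -- the dynamic variance bound for `fp`
  have h := wilson_solution_variance_le_uniform L β' hβ hfpC t x₀ Ω P W hW U hU0 hU (wilson_loopAverage_carre_le L β' _ _)
  -- bookkeeping: `Y = fp(coords U_t) = W̄(U_t)`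
  have hmU : Measurable (U t) := (hU.adapted t).mono (hW.natFiltration.le t) le_rfl
  have cY : Continuous fun V : (GaugeConfig 3 L (Matrix.specialUnitaryGroup (Fin 2) ℂ)) => fp (co V) := hfpC.continuous.comp (continuous_coords (L := L))
  obtain ⟨M, hM⟩ : ∃ M, ∀ V : (GaugeConfig 3 L (Matrix.specialUnitaryGroup (Fin 2) ℂ)), |fp (co V)| ≤ M := by
    obtain ⟨M, hM⟩ := isCompact_univ.exists_bound_of_continuousOn cY.continuousOn
    exact ⟨M, fun V => by simpa [Real.norm_eq_abs] using hM V (Set.mem_univ V)⟩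
  have hYm : AEStronglyMeasurable (fun ω => fp (co (U t ω))) P := (cY.measurable.comp hmU).aestronglyMeasurable
  have iY : Integrable (fun ω => fp (co (U t ω))) P :=
    Integrable.of_bound hYm M (ae_of_all _ fun ω => by rw [Real.norm_eq_abs]; exact hM _)
  have iYY : Integrable (fun ω => fp (co (U t ω)) * fp (co (U t ω))) P := by
    refine Integrable.of_bound (hYm.mul hYm) (M * M) (ae_of_all _ fun ω => ?_)
    rw [Real.norm_eq_abs, abs_mul]
    have hM0 : 0 ≤ M := (abs_nonneg _).trans (hM (U t ω))
    exact mul_le_mul (hM _) (hM _) (abs_nonneg _) hM0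
  set m : ℝ := ∫ ω, fp (co (U t ω)) ∂P with hm
  have hexpand : ∫ ω, (fp (co (U t ω)) - m) ^ 2 ∂P = ∫ ω, fp (co (U t ω)) * fp (co (U t ω)) ∂P - m ^ 2 := by
    have e1 : (fun ω => (fp (co (U t ω)) - m) ^ 2) = fun ω => fp (co (U t ω)) * fp (co (U t ω)) - 2 * m * fp (co (U t ω)) + m ^ 2 := by
      funext ω; ring
    have i2 : Integrable (fun ω => 2 * m * fp (co (U t ω))) P := iY.const_mul _
    have i12 : Integrable (fun ω => fp (co (U t ω)) * fp (co (U t ω)) - 2 * m * fp (co (U t ω))) P := iYY.sub i2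
    rw [e1, integral_add i12 (integrable_const _), integral_sub iYY i2, integral_const_mul, integral_const]
    simp only [probReal_univ, smul_eq_mul, one_mul]
    rw [← hm]; ring
  have hX : ∀ ω, (((Fintype.card (Site 3 L) : ℝ))⁻¹ * ∑ x : Site 3 L, wilsonLoop (fundamentalRep (Fin 2)) x i j R T (U t ω)) = fp (co (U t ω)) := fun ω => (hval (U t ω)).symm
  have hEX : ∫ ω', (((Fintype.card (Site 3 L) : ℝ))⁻¹ * ∑ x : Site 3 L, wilsonLoop (fundamentalRep (Fin 2)) x i j R T (U t ω')) ∂P = m := by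
    rw [hm]; exact integral_congr_ae (ae_of_all _ fun ω' => hX ω')
  have hsq : ∀ ω, ((((Fintype.card (Site 3 L) : ℝ))⁻¹ * ∑ x : Site 3 L, wilsonLoop (fundamentalRep (Fin 2)) x i j R T (U t ω)) - ∫ ω', (((Fintype.card (Site 3 L) : ℝ))⁻¹ * ∑ x : Site 3 L, wilsonLoop (fundamentalRep (Fin 2)) x i j R T (U t ω')) ∂P) ^ 2 = (fp (co (U t ω)) - m) ^ 2 := fun ω => by rw [hEX, hX]
  rw [integral_congr_ae (ae_of_all _ fun ω => hsq ω), hexpand]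
  have hconst : (32 * ((2 * (Fintype.card (Site 3 L) : ℝ))⁻¹) ^ 2 * (((((List.range R).map (fun m : ℕ => ((Pi.single i ((m : ℕ) : ZMod L) : Site 3 L), i, false)) ++ (List.range T).map (fun m : ℕ => ((Pi.single i ((R : ℕ) : ZMod L) : Site 3 L) + (Pi.single j ((m : ℕ) : ZMod L) : Site 3 L), j, false)) ++ ((List.range R).map (fun m : ℕ => ((Pi.single j ((T : ℕ) : ZMod L) : Site 3 L) + (Pi.single i ((m : ℕ) : ZMod L) : Site 3 L), i, true))).reverse ++ ((List.range T).map (fun m : ℕ => ((Pi.single j ((m : ℕ) : ZMod L) : Site 3 L), j, true))).reverse)).length : ℕ) : ℝ) ^ 2 * Fintype.card (Edge 3 L)) / (2 * (1 - 12 * |β'|)) =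
      48 * ((R : ℝ) + T) ^ 2 / ((1 - 12 * |β'|) * (Fintype.card (Site 3 L) : ℝ)) := by
    rw [rectShape_length, card_edge_eq_three_mul_card_site]
    push_cast
    field_simp
    ring
  rw [← hconst]
  exact h

/-- ★★ **Dynamic concentration of spatially averaged Wilson loops at the route's cut-offs, inside the window `γε_K > 6`.**  For every cut-off
`K` with `6 < γε_K`, directions `i, j`, side lengths `R, T`, every strong solution `U` of the SZZ SDE at `β'_K = (γε_K)⁻¹/2` on the `K`-th
lattice from a deterministic start (e.g. the cold start) and every lattice time `t`:
`∫ (W̄_(R×T)(U_t) − E[W̄_(R×T)(U_t)])² dP ≤ 48(R+T)²/((1 − 6/(γε_K))·L_K³)`. [cite: BakryGentilLedoux2014, Thm 4.7.2 (ii)] -/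
theorem wilsonLoop_dynamicVariance_fixedCutoff_window (F : T3ContinuumYM3Torus.T3Family) (γ : ℝ) (K : ℕ) (hK : 6 < γ * (F.P K).eps)
    (i j : Fin 3) (R T : ℕ) (t : ℝ≥0) (x₀ : GaugeConfig 3 ((F.P K).sitesPerDir 0) (Matrix.specialUnitaryGroup (Fin 2) ℂ))
    (Ω : Type) [MeasurableSpace Ω] (P : Measure Ω) [IsProbabilityMeasure P]
    (W : ℝ≥0 → Ω → (Edge 3 ((F.P K).sitesPerDir 0) × NoiseIdx 2 → ℝ)) (hW : IsFlatBrownian W P)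
    (U : ℝ≥0 → Ω → GaugeConfig 3 ((F.P K).sitesPerDir 0) (Matrix.specialUnitaryGroup (Fin 2) ℂ)) (hU0 : ∀ ω, U 0 ω = x₀)
    (hU : (latticeLangevinDynamics (fundamentalLatticeRep 2) ((γ * (F.P K).eps)⁻¹ / 2)).IsSolution (fundamentalRep (Fin 2)) hW.natFiltration P W U) :
    ∫ ω, ((((((((F.P K).sitesPerDir 0) : ℕ) : ℝ) ^ 3))⁻¹ * ∑ x : Site 3 ((F.P K).sitesPerDir 0), wilsonLoop (fundamentalRep (Fin 2)) x i j R T (U t ω)) -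
        ∫ ω', (((((((F.P K).sitesPerDir 0) : ℕ) : ℝ) ^ 3))⁻¹ * ∑ x : Site 3 ((F.P K).sitesPerDir 0), wilsonLoop (fundamentalRep (Fin 2)) x i j R T (U t ω')) ∂P) ^ 2 ∂P ≤
      48 * ((R : ℝ) + T) ^ 2 / ((1 - 6 / (γ * (F.P K).eps)) * ((((F.P K).sitesPerDir 0) : ℕ) : ℝ) ^ 3) := by
  obtain ⟨hβ, hrate⟩ := window_coupling_bounds F γ K hK
  have h := wilson_solution_loopAverage_variance_le_uniform ((F.P K).sitesPerDir 0) ((γ * (F.P K).eps)⁻¹ / 2) hβ i j R T t x₀ Ω P W hW U hU0 hU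
  rw [(card_site_plaquette_fixedCutoff F K).1, hrate] at h
  exact h

end Summit.QuantumFields.YangMills.Theorems.ColdStartUniversality
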